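/-
Origin: expansion seat `prover-pub-hodgecm-mc-binder-2-g7-0`, handover #8 17:58Z md5 7078e473a1d8 (136 l.; imports #6 + K-1 v26 #K338 `KonnoKonno2007/JunctionVacuumOverlapPhase` (glue-2-g25 18:01Z; cone #K332–#K337) — INSTALL AFTER #K338; `exists_isArchWeilDatum_slot [Nonempty P'] [IsEmpty Q'] [Subsingleton S'] r₀ s₀` = the small datum of the census slot (V_v definite, W_v ≅ U(1,1)) from theta-1's `isArchWeilDatum_linWeil_neg_card` + `isArchWeilDatum_swap`; `cmBlockRepAt_one_hypV_tensorPi_slot` / `tendsto_cmBlockRepAt_one_hypV_tensorPi_sub_div_slot` = #6 hypothesis-free; farm amalgam rc 0 / 0 warn, axioms trio) (`HOME/mc/pub-hodgecm-mc-binder-2/g7/pkg/HodgeCM/Model/HypCensus/SmoothBlockSlot.lean`, md5 7078e473, 136 lines);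
landed by the gen-12 packager (p-g12) in gate run 36 as `HodgeCM/Model/HypCensus/SmoothBlockSlot.lean` (verbatim).
-/
/-
Origin: speedrun cell pub-hodgecm, MODEL-CONSTRUCTION sub-cell, lineage mc-binder-2 (rows A12/A34 of the binder ledger:
`hyp12` / `hyp34`), seat prover-pub-hodgecm-mc-binder-2-g7-0 (gen 7), 2026-08-19.  Target in PKG:
`HodgeCM/Model/HypCensus/SmoothBlockSlot.lean` (NEW additive leaf; imports this lineage's `SmoothBlock` and the K-1 twin of
`KonnoKonno2007/JunctionVacuumOverlapPhase` — NOT YET VENDORED at filing time: install only after glue-2 ships that twin and its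
cone `JunctionVacuumOverlap`, `JunctionLinearWeilDatum`, …).  KERNEL only: 0 records / named facts / proof holes.
-/
import Summits.HodgeConjecture.HodgeCM.Model.HypCensus.SmoothBlock
import Literature.RepresentationTheory.KonnoKonno2007.JunctionVacuumOverlapPhase

/-!
# Census kit (rows A12/A34), junction (J-smooth): the small datum of the census slot, and the slope hypothesis-free

`SmoothBlock` proves the exact value and the Schwartz slope of the CM pin's archimedean Weil datum along the `W`-side boost
at a real place `v`, for ANY small archimedean Weil datum `ω₁` of the slot `U(P',Q') × U(R',S')` (hypothesis `hW₁`, as in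
BRICK-4 § 2).  At a place of type `Σ₁₂` the slot is `V_v` DEFINITE (`Q' = ∅`, `P'` nonempty) and `W_v ≅ U(1,1)` (`S'` a
subsingleton with a point `s₀`, `R'` with a point `r₀`).  There theta-1's UNCONDITIONAL linearised datum
`RealDualPair.isArchWeilDatum_linWeil_neg_card` on the swapped slot `U(R',S') × U(P',∅)` ([Folland1989, §4.2 Prop. (4.39)]; the
radial-ladder proof of the vacuum-overlap phase) and the swap symmetry `RealDualPair.isArchWeilDatum_swap` give the small datum:

* §1 **`exists_isArchWeilDatum_slot`** — `∃ ω₁, IsArchWeilDatum (ι𝕎 P' Q' R' S') ω₁ ∧ ∀ u, Continuous (ω₁ u)` in that slot;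
* §2 **`cmBlockRepAt_one_hypV_tensorPi_slot`**, **`tendsto_cmBlockRepAt_one_hypV_tensorPi_sub_div_slot`** — `SmoothBlock` §1/§2
  with `hW₁ hc₁` discharged.

Nothing here is a claim of PerL/QW8; the bracketed references are provenance of the tree theorems used.
Style lint (L-notation): no `local notation`.
-/

set_option autoImplicit false

noncomputable section

open Filter Topology
open NumberField NumberField.InfinitePlace IsDedekindDomain MeasureTheory
open scoped Matrix
open scoped Kronecker Classical TensorProduct ComplexConjugate
open Literature.NumberTheory.Automorphic Literature.NumberTheory.Automorphic.UnitaryGroup Literature.NumberTheory.Weil1964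
open Literature.RepresentationTheory.HeisenbergGroup (polar Heisenberg symplecticGroup ofSymplectic)
open Literature.RepresentationTheory.KonnoKonno2007 Literature.RepresentationTheory.KonnoKonno2007.RealDualPair
open Literature.NumberTheory.GelbartRogawski1991 Literature.NumberTheory.GelbartRogawski1991.UnitaryDualPair
open Literature.Analysis.SegalBargmann Literature.Analysis.Distribution

namespace HodgeCM.Model.HypCensus

/-! ## §1 The small datum of the census slot -/

section Slot

variable {P' Q' R' S' : Type} [Fintype P'] [DecidableEq P'] [Fintype Q'] [DecidableEq Q'] [Fintype R'] [DecidableEq R']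
  [Fintype S'] [DecidableEq S']

/-- **Non-vacuity of the small-datum hypothesis in the census slot.**  If the `V`-block is definite (`Q' = ∅`, `P'` nonempty)
and the `W`-block is a hyperbolic plane-like slot (`S'` a subsingleton, points `r₀ : R'`, `s₀ : S'`), an archimedean Weil datum of
`U(P',Q') × U(R',S')` with continuous operators EXISTS: theta-1's `linWeil` datum on the swapped slot, transported by the swap.
[Folland1989, §4.2 Prop. (4.39); KonnoKonno2007, §3.1] -/
theorem exists_isArchWeilDatum_slot [Nonempty P'] [IsEmpty Q'] [Subsingleton S'] (r₀ : R') (s₀ : S') :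
    ∃ ω₁ : Representation ℂ (Ginf P' Q' R' S') (SchwartzMap (DPIdx P' Q' R' S' → ℝ) ℂ),
      IsArchWeilDatum (ι𝕎 P' Q' R' S') ω₁ ∧ ∀ u, Continuous (ω₁ u) := by
  obtain ⟨ω, hω, -, hlin⟩ := isArchWeilDatum_linWeil_neg_card (P := R') (Q := S') (R := P') (S := Q') r₀ s₀
  -- the operators of theta-1's linearised datum are scalar multiples of the (continuous) vacuum section
  have hc : ∀ g, Continuous (ω g) := fun g => by
    have h1 : ∀ f, ω g f = linPhase P' Q' s₀ (-((Fintype.card P' : ℕ) : ℤ)) g •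
        vacSection (fun g : Ginf R' S' P' Q' => (⇑((ι𝕎 R' S' P' Q' g).1 :
          ((DPIdx R' S' P' Q' → ℝ) × (DPIdx R' S' P' Q' → ℝ)) ≃ₗ[ℝ] (DPIdx R' S' P' Q' → ℝ) × (DPIdx R' S' P' Q' → ℝ)) :
            PhaseMap (DPIdx R' S' P' Q'))) g f := fun f => by
      rw [hlin g, linWeil_apply]
    exact ((vacSection _ g).continuous.const_smul _).congr fun f => by simpa only [Pi.smul_apply] using (h1 f).symm
  refine ⟨_, isArchWeilDatum_swap hω, fun u => ?_⟩
  -- transport along the swap keeps the operators continuous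
  rw [show (repTransport (swapCLE R' S' P' Q') (ω.comp (swapHom R' S' P' Q')) u :
        SchwartzMap (DPIdx P' Q' R' S' → ℝ) ℂ → SchwartzMap (DPIdx P' Q' R' S' → ℝ) ℂ) =
      fun f => schwartzTransport (swapCLE R' S' P' Q')
        ((ω.comp (swapHom R' S' P' Q')) u ((schwartzTransport (swapCLE R' S' P' Q')).symm f)) from
    funext fun f => repTransport_apply _ _ _ _]
  exact (schwartzTransport (swapCLE R' S' P' Q')).continuous.comp
    ((hc _).comp (schwartzTransport (swapCLE R' S' P' Q')).symm.continuous)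

end Slot

/-! ## §2 `SmoothBlock` §1/§2 in the census slot, small datum discharged -/

section CMPinSmoothSlot

variable (L : Type) [Field L] [NumberField L] [IsCMField L] {N M n : ℕ} (e : Fin N × Fin M ≃ Fin n)
variable (dV : Fin N → L) (hdV : ∀ i, IsCMField.complexConj L (dV i) = dV i) (hdV0 : ∀ i, dV i ≠ 0)
variable (dW : Fin M → L) (hdW : ∀ i, IsCMField.complexConj L (dW i) = dW i) (hdW0 : ∀ i, dW i ≠ 0)
variable (hGR : (cmSplittingDatum L e dV hdV hdV0 dW hdW hdW0).CompatibleSplitting) (ι₁ : L →+* ℂ)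
variable (v : {v : InfinitePlace ↥(maximalRealSubfield L) // v.IsReal})
variable {P' Q' R' S' : Type} [Fintype P'] [DecidableEq P'] [Fintype Q'] [DecidableEq Q'] [Fintype R'] [DecidableEq R']
  [Fintype S'] [DecidableEq S']
variable (eP : PosIdx (cmXV L dV hdV ι₁ v) ≃ P') (eQ : NegIdx (cmXV L dV hdV ι₁ v) ≃ Q')
  (eR : PosIdx (cmXW L dV dW hdW ι₁ v) ≃ R') (eS : NegIdx (cmXW L dV dW hdW ι₁ v) ≃ S')
variable
  (h₁V : ∃ i₀ : Fin N, (∀ i, i ≠ i₀ → 0 < (ι₁ (dV i)).re) ∨ ∀ i, i ≠ i₀ → (ι₁ (dV i)).re < 0)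
  (h₁W : (∀ j, 0 < (ι₁ (dW j)).re) ∨ ∀ j, (ι₁ (dW j)).re < 0)
  (hV : ∀ τ : L →+* ℂ, InfinitePlace.mk τ ≠ InfinitePlace.mk ι₁ →
    (∀ i, 0 < (τ (dV i)).re) ∨ ∀ i, (τ (dV i)).re < 0)
  (hW : ∀ τ : L →+* ℂ, InfinitePlace.mk τ ≠ InfinitePlace.mk ι₁ →
    (∃ j₀ : Fin M, ∀ j, j ≠ j₀ → 0 < (τ (dW j)).re) ∨ ∀ j, (τ (dW j)).re < 0)

include h₁V h₁W hV hW in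
/-- **(J-smooth), exact value, census slot** (`V_v` definite, `W_v ≅ U(1,1)`): no small-datum hypothesis left.
[Folland1989, Prop. (1.43), §4.2 (4.23), (4.24), Prop. (4.39)] -/
theorem cmBlockRepAt_one_hypV_tensorPi_slot [Nonempty P'] [IsEmpty Q'] [Subsingleton S'] (r₀ : R') (s₀ : S') (t : ℝ)
    (Φ₁ : SchwartzMap (DPIdx P' Q' R' S' → ℝ) ℂ)
    (Φ₂ : SchwartzMap (Fin n × {w : {w : InfinitePlace ↥(maximalRealSubfield L) // w.IsReal} // w ≠ v} → ℝ) ℂ) :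
    cmBlockRepAt L e dV hdV hdV0 dW hdW hdW0 hGR ι₁ v eP eQ eR eS
        (cmBlockSectionAt L dV hdV hdV0 dW hdW hdW0 ι₁ v eP eQ eR eS
          (((1 : UForm P' Q'), (hypV r₀ s₀ t : UForm R' S')) : Ginf P' Q' R' S'))
        (tensorPi Φ₁ Φ₂) =
      tensorPi (hypOpW P' Q' r₀ s₀ t Φ₁) Φ₂ := by
  obtain ⟨ω₁, hW₁, hc₁⟩ := exists_isArchWeilDatum_slot (P' := P') (Q' := Q') r₀ s₀
  exact cmBlockRepAt_cmBlockSectionAt_one_hypV_tensorPi L e dV hdV hdV0 dW hdW hdW0 hGR ι₁ v eP eQ eR eS h₁V h₁W hV hW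
    hW₁ hc₁ r₀ s₀ t Φ₁ Φ₂

include h₁V h₁W hV hW in
/-- **(J-smooth), the slope, census slot**: `t⁻¹ • (ω′ (s (1, a_t)) (Φ₁ ⊠ Φ₂) − Φ₁ ⊠ Φ₂) → (hypOpWGen Φ₁) ⊠ Φ₂` in `𝓢`, no
small-datum hypothesis left.  [Folland1989, (4.24), Prop. (4.39)] -/
theorem tendsto_cmBlockRepAt_one_hypV_tensorPi_sub_div_slot [Nonempty P'] [IsEmpty Q'] [Subsingleton S'] (r₀ : R') (s₀ : S')
    (Φ₁ : SchwartzMap (DPIdx P' Q' R' S' → ℝ) ℂ)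
    (Φ₂ : SchwartzMap (Fin n × {w : {w : InfinitePlace ↥(maximalRealSubfield L) // w.IsReal} // w ≠ v} → ℝ) ℂ) :
    Tendsto (fun t : ℝ => ((t : ℝ) : ℂ)⁻¹ •
        (cmBlockRepAt L e dV hdV hdV0 dW hdW hdW0 hGR ι₁ v eP eQ eR eS
            (cmBlockSectionAt L dV hdV hdV0 dW hdW hdW0 ι₁ v eP eQ eR eS
              (((1 : UForm P' Q'), (hypV r₀ s₀ t : UForm R' S')) : Ginf P' Q' R' S'))
            (tensorPi Φ₁ Φ₂) - tensorPi Φ₁ Φ₂))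
      (𝓝[≠] 0) (𝓝 (tensorPi (hypOpWGen P' Q' r₀ s₀ Φ₁) Φ₂)) := by
  obtain ⟨ω₁, hW₁, hc₁⟩ := exists_isArchWeilDatum_slot (P' := P') (Q' := Q') r₀ s₀
  exact tendsto_cmBlockRepAt_one_hypV_tensorPi_sub_div L e dV hdV hdV0 dW hdW hdW0 hGR ι₁ v eP eQ eR eS h₁V h₁W hV hW
    hW₁ hc₁ r₀ s₀ Φ₁ Φ₂

end CMPinSmoothSlot

end HodgeCM.Model.HypCensus

end
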